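import Mathlib.Analysis.SpecialFunctions.Log.Base
import Mathlib.Analysis.SpecialFunctions.Pow.Real
import Mathlib.Data.Nat.Size
import Mathlib.Analysis.Complex.ExponentialBounds
import Mathlib.Tactic
import HarnessLib

/-!
# Integer floating-point bookkeeping for infrastructure distances

Topic `Computability/Cryptography` (support for the polynomial-time reduction of the fundamental unit
modulo `m`, `UnitResidueAlgorithm.lean`). Distances in the infrastructure of a real quadratic order
are logarithms of products of up to `2^{O(log Δ)}` quadratic irrationals; the classical algorithms
carry them as floating-point approximations with a rigorous error budget (Jacobson–Williams, Ch. 11,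
"(f, p) representations": a pair `(d, k)` with `|2^p θ / 2^k d - 1| < f/2^p`). This file is a minimal
integer-only version sufficient for a polynomial-time bound:

* a float is a pair `(M, E) ∈ ℤ²` of value `val M E = M · 2^E`, *normalised* at precision `P` when
  `2^P ≤ M < 2^{P+1}` (`IsNorm`); then `⌊log₂ val⌋ = E + P` (`IsNorm.logb_bounds`);
* `mulF` — product with truncation to `P + 1` bits: normalised, and
  `val ≤ v₁ v₂ < val (1 + 2^{-P})` (`mulF_spec`);
* `floatOf u v` — the float of a positive rational `u/v`: normalised, `val ≤ u/v < val (1 + 2^{-P})`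
  (`floatOf_spec`), whenever `size u ≤ P + 3 + size v`;
* the logarithmic accuracy predicate `Acc P M E x ε` (`|log₂ val - log₂ x| ≤ ε`) and its algebra:
  `Acc.mulF` (errors add, plus `2^{1-P}` per product), `Acc.floatOf`, `Acc.congr_right`,
  `Acc.logb_bounds` (reading `⌊log₂ x⌋` off `E + P` up to the error), `abs_logb_sub_logb_le`
  (one unit in the last place of a `k`-bit integer costs `2^{2-k}`).

All statements are elementary real analysis (`Real.logb`); everything is proved, no named facts.

## References

* M. J. Jacobson, Jr., H. C. Williams, *Solving the Pell Equation*, CMS Books in Mathematics, Springer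
  (2009), Ch. 11 (`(f, p)` representations), §11.1 Def. 11.1, Lemma 11.3. [JacobsonWilliams2008]
* D. E. Knuth, *The Art of Computer Programming*, Vol. 2, 3rd ed. (1998), §4.2.1 (normalised
  floating point, truncation error). [KnuthTAOCP2]
-/

noncomputable section

namespace Literature.Computability.Cryptography.UnitResidue

/-! ### Sizes -/

/-- Bit size of (the nonnegative part of) an integer. [folklore] -/
def isize (z : ℤ) : ℕ := Nat.size z.toNat

/-- `z < 2^{size z}` for `z ≥ 0`. [folklore] -/
theorem lt_two_pow_isize {z : ℤ} (hz : 0 ≤ z) : z < (2 : ℤ) ^ isize z := by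
  have h := Nat.lt_size_self z.toNat
  have : ((z.toNat : ℕ) : ℤ) < (2 : ℤ) ^ Nat.size z.toNat := by exact_mod_cast h
  rwa [Int.toNat_of_nonneg hz] at this

/-- `2^{size z - 1} ≤ z` for `z ≥ 1`. [folklore] -/
theorem two_pow_isize_sub_one_le {z : ℤ} (hz : 1 ≤ z) : (2 : ℤ) ^ (isize z - 1) ≤ z := by
  have hpos : 0 < z.toNat := by omega
  have hs : 0 < Nat.size z.toNat := Nat.size_pos.mpr hpos
  have h : 2 ^ (Nat.size z.toNat - 1) ≤ z.toNat := Nat.lt_size.mp (by omega)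
  have : ((2 ^ (Nat.size z.toNat - 1) : ℕ) : ℤ) ≤ (z.toNat : ℤ) := by exact_mod_cast h
  rw [Int.toNat_of_nonneg (by omega)] at this
  exact_mod_cast this

/-- `size z ≤ k ↔ z < 2^k` for `z ≥ 0`. [folklore] -/
theorem isize_le_iff {z : ℤ} (hz : 0 ≤ z) {k : ℕ} : isize z ≤ k ↔ z < (2 : ℤ) ^ k := by
  unfold isize
  rw [Nat.size_le]
  constructor
  · intro h
    have : ((z.toNat : ℕ) : ℤ) < (2 : ℤ) ^ k := by exact_mod_cast h
    rwa [Int.toNat_of_nonneg hz] at this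
  · intro h
    have : ((z.toNat : ℕ) : ℤ) < ((2 ^ k : ℕ) : ℤ) := by rw [Int.toNat_of_nonneg hz]; exact_mod_cast h
    exact_mod_cast this

/-! ### Floats -/

/-- The value `M · 2^E` of a float. [cite: KnuthTAOCP2, §4.2.1] -/
def val (M E : ℤ) : ℝ := (M : ℝ) * (2 : ℝ) ^ E

/-- Normalised mantissa at precision `P`: `2^P ≤ M < 2^{P+1}`. [cite: KnuthTAOCP2, §4.2.1] -/
def IsNorm (P : ℕ) (M : ℤ) : Prop := (2 : ℤ) ^ P ≤ M ∧ M < (2 : ℤ) ^ (P + 1)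

/-- **Product with truncation** to `P + 1` bits. [cite: KnuthTAOCP2, §4.2.1 (Algorithm M)] -/
def mulF (P : ℕ) (M₁ E₁ M₂ E₂ : ℤ) : ℤ × ℤ :=
  if M₁ * M₂ < (2 : ℤ) ^ (2 * P + 1) then (M₁ * M₂ / (2 : ℤ) ^ P, E₁ + E₂ + P)
  else (M₁ * M₂ / (2 : ℤ) ^ (P + 1), E₁ + E₂ + P + 1)

/-- The shift `t = P + 3 + size v - size u` used by `floatOf`. [folklore] -/
def floatT (P : ℕ) (u v : ℤ) : ℕ := P + 3 + isize v - isize u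

/-- The wide mantissa `⌊u 2^t / v⌋` used by `floatOf`. [folklore] -/
def floatM1 (P : ℕ) (u v : ℤ) : ℤ := u * (2 : ℤ) ^ floatT P u v / v

/-- The final shift `size M₁ - (P + 1)` used by `floatOf`. [folklore] -/
def floatSh (P : ℕ) (u v : ℤ) : ℕ := isize (floatM1 P u v) - (P + 1)

/-- **The float of a positive rational `u/v`**: `M = ⌊u 2^t / v⌋ >> sh`, `E = sh - t`.
[cite: KnuthTAOCP2, §4.2.1 (normalisation)] -/
def floatOf (P : ℕ) (u v : ℤ) : ℤ × ℤ :=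
  (floatM1 P u v / (2 : ℤ) ^ floatSh P u v, (floatSh P u v : ℤ) - floatT P u v)

/-! ### Values and logarithms -/

/-- `2^E > 0`. [folklore] -/
theorem two_zpow_pos (E : ℤ) : (0 : ℝ) < (2 : ℝ) ^ E := zpow_pos (by norm_num) E

/-- A normalised float is positive. [folklore] -/
theorem IsNorm.val_pos {P : ℕ} {M : ℤ} (h : IsNorm P M) (E : ℤ) : 0 < val M E := by
  have : (0 : ℝ) < M := by
    have h1 : (0 : ℤ) < 2 ^ P := pow_pos (by norm_num) P
    exact_mod_cast lt_of_lt_of_le h1 h.1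
  exact mul_pos this (two_zpow_pos E)

/-- `log₂ (2^k) = k`. [folklore] -/
theorem logb_two_zpow (k : ℤ) : Real.logb 2 ((2 : ℝ) ^ k) = k := by
  rw [← Real.rpow_intCast, Real.logb_rpow (by norm_num) (by norm_num)]

/-- `2^{E + n} = 2^E · 2^n` mixing integer and natural exponents. [folklore] -/
theorem two_zpow_add_nat (E : ℤ) (n : ℕ) : (2 : ℝ) ^ (E + n) = (2 : ℝ) ^ E * (2 : ℝ) ^ n := by
  rw [zpow_add₀ (by norm_num : (2 : ℝ) ≠ 0), zpow_natCast]

/-- **`⌊log₂ val⌋ = E + P` for a normalised float**: `E + P ≤ log₂ (val M E) < E + P + 1`.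
[cite: KnuthTAOCP2, §4.2.1] -/
theorem IsNorm.logb_bounds {P : ℕ} {M : ℤ} (h : IsNorm P M) (E : ℤ) :
    ((E + P : ℤ) : ℝ) ≤ Real.logb 2 (val M E) ∧ Real.logb 2 (val M E) < ((E + P + 1 : ℤ) : ℝ) := by
  have hv := h.val_pos E
  have h1 : (2 : ℝ) ^ ((E + P : ℤ)) ≤ val M E := by
    rw [two_zpow_add_nat, mul_comm]
    unfold val
    apply mul_le_mul_of_nonneg_right _ (two_zpow_pos E).le
    have : ((2 : ℤ) ^ P : ℤ) ≤ M := h.1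
    exact_mod_cast this
  have h2 : val M E < (2 : ℝ) ^ ((E + P + 1 : ℤ)) := by
    rw [show (E + P + 1 : ℤ) = E + ((P + 1 : ℕ) : ℤ) by push_cast; ring, two_zpow_add_nat, mul_comm]
    unfold val
    apply mul_lt_mul_of_pos_right _ (two_zpow_pos E)
    have : M < (2 : ℤ) ^ (P + 1) := h.2
    exact_mod_cast this
  constructor
  · rw [← logb_two_zpow]
    exact Real.logb_le_logb_of_le (by norm_num) (two_zpow_pos _) h1
  · rw [← logb_two_zpow (E + P + 1)]
    exact Real.logb_lt_logb (by norm_num) hv h2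

/-- `val` is multiplicative: `val M₁ E₁ · val M₂ E₂ = val (M₁M₂) (E₁ + E₂)`. [folklore] -/
theorem val_mul (M₁ E₁ M₂ E₂ : ℤ) : val M₁ E₁ * val M₂ E₂ = val (M₁ * M₂) (E₁ + E₂) := by
  unfold val
  rw [zpow_add₀ (by norm_num : (2 : ℝ) ≠ 0)]
  push_cast
  ring

/-- `val M (E + n) = val M E · 2^n`. [folklore] -/
theorem val_add_nat (M E : ℤ) (n : ℕ) : val M (E + n) = val M E * (2 : ℝ) ^ n := by
  unfold val; rw [two_zpow_add_nat]; ring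

/-- **Truncation**: if `2^{P+D} ≤ Q < 2^{P+1+D}` then `Q / 2^D` is normalised and
`val (Q/2^D) (E + D) ≤ val Q E < val (Q/2^D) (E + D) · (1 + 1/2^P)`.
[cite: KnuthTAOCP2, §4.2.1 (truncation error at most one unit in the last place)] -/
theorem trunc_spec {P D : ℕ} {Q : ℤ} (hlo : (2 : ℤ) ^ (P + D) ≤ Q) (hhi : Q < (2 : ℤ) ^ (P + 1 + D)) (E : ℤ) :
    IsNorm P (Q / (2 : ℤ) ^ D) ∧ val (Q / (2 : ℤ) ^ D) (E + D) ≤ val Q E ∧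
      val Q E < val (Q / (2 : ℤ) ^ D) (E + D) * (1 + 1 / (2 : ℝ) ^ P) := by
  have hD : (0 : ℤ) < 2 ^ D := pow_pos (by norm_num) D
  set Mz := Q / (2 : ℤ) ^ D with hMz
  have hM_lo : (2 : ℤ) ^ P ≤ Mz := Int.le_ediv_of_mul_le hD (by rw [← pow_add]; exact hlo)
  have hM_hi : Mz < (2 : ℤ) ^ (P + 1) := Int.ediv_lt_of_lt_mul hD (by rw [← pow_add]; exact hhi)
  have hfl : Mz * 2 ^ D ≤ Q := Int.ediv_mul_le Q hD.ne'
  have hfh : Q < (Mz + 1) * 2 ^ D := Int.lt_ediv_add_one_mul_self Q hD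
  refine ⟨⟨hM_lo, hM_hi⟩, ?_, ?_⟩
  · rw [val_add_nat]
    unfold val
    have h1 : ((Mz : ℝ)) * (2 : ℝ) ^ D ≤ Q := by exact_mod_cast hfl
    have hE := two_zpow_pos E
    nlinarith
  · rw [val_add_nat]
    unfold val
    have h1 : (Q : ℝ) < ((Mz : ℝ) + 1) * (2 : ℝ) ^ D := by exact_mod_cast hfh
    have h2 : (2 : ℝ) ^ P ≤ Mz := by exact_mod_cast hM_lo
    have hE := two_zpow_pos E
    have hP : (0 : ℝ) < (2 : ℝ) ^ P := by positivity
    have hDr : (0 : ℝ) < (2 : ℝ) ^ D := by positivity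
    -- `Q 2^E < (Mz + 1) 2^D 2^E ≤ Mz 2^D 2^E (1 + 1/2^P)`
    have key : ((Mz : ℝ) + 1) ≤ Mz * (1 + 1 / (2 : ℝ) ^ P) := by
      rw [mul_add, mul_one, add_le_add_iff_left, mul_one_div, le_div_iff₀ hP]
      linarith
    calc (Q : ℝ) * 2 ^ E < ((Mz : ℝ) + 1) * (2 : ℝ) ^ D * 2 ^ E := by nlinarith
      _ ≤ (Mz : ℝ) * (1 + 1 / (2 : ℝ) ^ P) * (2 : ℝ) ^ D * 2 ^ E := by gcongr
      _ = (Mz : ℝ) * 2 ^ E * (2 : ℝ) ^ D * (1 + 1 / (2 : ℝ) ^ P) := by ring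

/-- **The truncated product is normalised and within one ulp below the exact product.**
[cite: KnuthTAOCP2, §4.2.1 (Algorithm M)] -/
theorem mulF_spec {P : ℕ} {M₁ M₂ : ℤ} (h₁ : IsNorm P M₁) (h₂ : IsNorm P M₂) (E₁ E₂ : ℤ) :
    IsNorm P (mulF P M₁ E₁ M₂ E₂).1 ∧
      val (mulF P M₁ E₁ M₂ E₂).1 (mulF P M₁ E₁ M₂ E₂).2 ≤ val M₁ E₁ * val M₂ E₂ ∧
      val M₁ E₁ * val M₂ E₂ < val (mulF P M₁ E₁ M₂ E₂).1 (mulF P M₁ E₁ M₂ E₂).2 * (1 + 1 / (2 : ℝ) ^ P) := by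
  have hQlo : (2 : ℤ) ^ (P + P) ≤ M₁ * M₂ := by
    rw [pow_add]; exact mul_le_mul h₁.1 h₂.1 (by positivity) (le_trans (by positivity) h₁.1)
  have hM₁ : (0 : ℤ) ≤ M₁ := le_trans (by positivity) h₁.1
  have hQhi : M₁ * M₂ < (2 : ℤ) ^ (P + 1 + (P + 1)) := by
    rw [pow_add]
    exact mul_lt_mul'' h₁.2 h₂.2 hM₁ (le_trans (by positivity) h₂.1)
  rw [val_mul]
  unfold mulF
  split_ifs with hc
  · have h := trunc_spec (P := P) (D := P) (Q := M₁ * M₂) hQlo (by rw [show P + 1 + P = 2 * P + 1 by ring]; exact hc) (E₁ + E₂)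
    simpa using h
  · push Not at hc
    have h := trunc_spec (P := P) (D := P + 1) (Q := M₁ * M₂)
      (by rw [show P + (P + 1) = 2 * P + 1 by ring]; exact hc) hQhi (E₁ + E₂)
    have e : E₁ + E₂ + ((P + 1 : ℕ) : ℤ) = E₁ + E₂ + P + 1 := by push_cast; ring
    rw [e] at h
    exact h

/-! ### The float of a rational -/

/-- Bounds on the wide mantissa: `2^{P+2} ≤ ⌊u 2^t / v⌋ < 2^{P+4}`. [folklore] -/
theorem floatM1_bounds {P : ℕ} {u v : ℤ} (hu : 1 ≤ u) (hv : 1 ≤ v) (hsz : isize u ≤ P + 3 + isize v) :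
    (2 : ℤ) ^ (P + 2) ≤ floatM1 P u v ∧ floatM1 P u v < (2 : ℤ) ^ (P + 4) := by
  have hsu : 1 ≤ isize u := by
    by_contra h; push Not at h
    have := (isize_le_iff (by omega : (0:ℤ) ≤ u)).mp (by omega : isize u ≤ 0)
    simp at this; omega
  have hu_lo := two_pow_isize_sub_one_le hu
  have hu_hi := lt_two_pow_isize (by omega : (0:ℤ) ≤ u)
  have hv_lo := two_pow_isize_sub_one_le hv
  have hv_hi := lt_two_pow_isize (by omega : (0:ℤ) ≤ v)
  have ht : floatT P u v + isize u = P + 3 + isize v := by unfold floatT; omega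
  unfold floatM1
  set t := floatT P u v
  constructor
  · apply Int.le_ediv_of_mul_le (by omega)
    -- `2^{P+2} v ≤ 2^{P+2+sv} ≤ u 2^t` as `2^{su - 1} 2^t = 2^{P+2+sv}`
    have h1 : (2 : ℤ) ^ (P + 2) * v ≤ (2 : ℤ) ^ (P + 2) * (2 : ℤ) ^ isize v :=
      mul_le_mul_of_nonneg_left hv_hi.le (by positivity)
    have h2 : (2 : ℤ) ^ (isize u - 1) * (2 : ℤ) ^ t ≤ u * (2 : ℤ) ^ t :=
      mul_le_mul_of_nonneg_right hu_lo (by positivity)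
    have e : (2 : ℤ) ^ (P + 2) * (2 : ℤ) ^ isize v = (2 : ℤ) ^ (isize u - 1) * (2 : ℤ) ^ t := by
      rw [← pow_add, ← pow_add]; congr 1; omega
    linarith
  · apply Int.ediv_lt_of_lt_mul (by omega)
    have h1 : u * (2 : ℤ) ^ t < (2 : ℤ) ^ isize u * (2 : ℤ) ^ t :=
      mul_lt_mul_of_pos_right hu_hi (by positivity)
    have h2 : (2 : ℤ) ^ (P + 4) * (2 : ℤ) ^ (isize v - 1) ≤ (2 : ℤ) ^ (P + 4) * v :=
      mul_le_mul_of_nonneg_left hv_lo (by positivity)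
    have hsv : 1 ≤ isize v := by
      by_contra h; push Not at h
      have := (isize_le_iff (by omega : (0:ℤ) ≤ v)).mp (by omega : isize v ≤ 0)
      simp at this; omega
    have e : (2 : ℤ) ^ isize u * (2 : ℤ) ^ t = (2 : ℤ) ^ (P + 4) * (2 : ℤ) ^ (isize v - 1) := by
      rw [← pow_add, ← pow_add]; congr 1; omega
    linarith

/-- **The float of `u/v` is normalised and within one ulp below `u/v`.**
[cite: KnuthTAOCP2, §4.2.1 (normalisation and truncation)] -/
theorem floatOf_spec {P : ℕ} {u v : ℤ} (hu : 1 ≤ u) (hv : 1 ≤ v) (hsz : isize u ≤ P + 3 + isize v) :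
    IsNorm P (floatOf P u v).1 ∧ val (floatOf P u v).1 (floatOf P u v).2 ≤ u / v ∧
      (u : ℝ) / v < val (floatOf P u v).1 (floatOf P u v).2 * (1 + 1 / (2 : ℝ) ^ P) := by
  obtain ⟨hXlo, hXhi⟩ := floatM1_bounds hu hv hsz
  set X := floatM1 P u v with hX
  set t := floatT P u v with htdef
  have hX1 : 1 ≤ X := by
    have h0 : (0 : ℤ) < 2 ^ (P + 2) := by positivity
    omega
  have hsx_lo : P + 3 ≤ isize X := by
    by_contra h; push Not at h
    have := (isize_le_iff (by omega : (0:ℤ) ≤ X)).mp (by omega : isize X ≤ P + 2)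
    linarith
  have hsx_hi : isize X ≤ P + 4 := (isize_le_iff (by omega : (0:ℤ) ≤ X)).mpr hXhi
  have hsh : floatSh P u v + (P + 1) = isize X := by
    show isize (floatM1 P u v) - (P + 1) + (P + 1) = isize X
    rw [← hX]; omega
  set sh := floatSh P u v with hshdef
  -- truncation of `X` by `sh` bits
  have htr := trunc_spec (P := P) (D := sh) (Q := X)
    (by have := two_pow_isize_sub_one_le hX1; rwa [show isize X - 1 = P + sh by omega] at this)
    (by have := lt_two_pow_isize (by omega : (0:ℤ) ≤ X); rwa [show isize X = P + 1 + sh by omega] at this)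
    (-(t : ℤ))
  have e : (floatOf P u v) = (X / (2 : ℤ) ^ sh, (-(t : ℤ)) + sh) := by
    unfold floatOf; rw [← hX, ← hshdef, ← htdef]; ext <;> simp; ring
  rw [e]
  obtain ⟨hN, hle, hlt⟩ := htr
  -- `val X (-t) ≤ u/v < val X (-t) + 2^{-t}`... via the floor `X = ⌊u 2^t / v⌋`
  have hvpos : (0 : ℝ) < v := by exact_mod_cast (by omega : (0:ℤ) < v)
  have hfl : X * v ≤ u * (2 : ℤ) ^ t := by rw [hX]; unfold floatM1; rw [← htdef]; exact Int.ediv_mul_le _ (by omega)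
  have hfh : u * (2 : ℤ) ^ t < (X + 1) * v := by
    rw [hX]; unfold floatM1; rw [← htdef]; exact Int.lt_ediv_add_one_mul_self _ (by omega)
  have hvalX : val X (-(t : ℤ)) ≤ u / v := by
    unfold val
    rw [zpow_neg, zpow_natCast, le_div_iff₀ hvpos]
    have h1 : ((X : ℝ)) * v ≤ u * (2 : ℝ) ^ t := by exact_mod_cast hfl
    have h2 : (0 : ℝ) < (2 : ℝ) ^ t := by positivity
    calc (X : ℝ) * ((2 : ℝ) ^ t)⁻¹ * v = (X * v) / (2 : ℝ) ^ t := by ring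
      _ ≤ u * (2 : ℝ) ^ t / (2 : ℝ) ^ t := by gcongr
      _ = u := by field_simp
  have hvalX' : (u : ℝ) / v < val (X + 1) (-(t : ℤ)) := by
    unfold val
    rw [zpow_neg, zpow_natCast, div_lt_iff₀ hvpos]
    have h1 : (u : ℝ) * (2 : ℝ) ^ t < ((X : ℝ) + 1) * v := by exact_mod_cast hfh
    have h2 : (0 : ℝ) < (2 : ℝ) ^ t := by positivity
    push_cast
    calc (u : ℝ) = u * (2 : ℝ) ^ t / (2 : ℝ) ^ t := by field_simp
      _ < ((X : ℝ) + 1) * v / (2 : ℝ) ^ t := by gcongr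
      _ = ((X : ℝ) + 1) * ((2 : ℝ) ^ t)⁻¹ * v := by ring
  refine ⟨hN, hle.trans hvalX, ?_⟩
  -- `u/v < val (X+1) (-t) ≤ val M (sh - t) (1 + 1/2^P)` where `X + 1 ≤ (M + 1) 2^sh`
  set Mz := X / (2 : ℤ) ^ sh
  have hD : (0 : ℤ) < 2 ^ sh := pow_pos (by norm_num) sh
  have hfh2 : X + 1 ≤ (Mz + 1) * 2 ^ sh := Int.lt_ediv_add_one_mul_self X hD
  have hP : (0 : ℝ) < (2 : ℝ) ^ P := by positivity
  have hMlo : (2 : ℝ) ^ P ≤ Mz := by exact_mod_cast hN.1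
  have key : val (X + 1) (-(t : ℤ)) ≤ val Mz (-(t : ℤ) + sh) * (1 + 1 / (2 : ℝ) ^ P) := by
    rw [val_add_nat]
    unfold val
    have h1 : ((X : ℝ) + 1) ≤ ((Mz : ℝ) + 1) * (2 : ℝ) ^ sh := by exact_mod_cast hfh2
    have hE := two_zpow_pos (-(t : ℤ))
    have hshp : (0 : ℝ) < (2 : ℝ) ^ sh := by positivity
    have k2 : ((Mz : ℝ) + 1) ≤ Mz * (1 + 1 / (2 : ℝ) ^ P) := by
      rw [mul_add, mul_one, add_le_add_iff_left, mul_one_div, le_div_iff₀ hP]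
      linarith
    push_cast
    calc ((X : ℝ) + 1) * 2 ^ (-(t : ℤ)) ≤ ((Mz : ℝ) + 1) * (2 : ℝ) ^ sh * 2 ^ (-(t : ℤ)) := by gcongr
      _ ≤ (Mz : ℝ) * (1 + 1 / (2 : ℝ) ^ P) * (2 : ℝ) ^ sh * 2 ^ (-(t : ℤ)) := by gcongr
      _ = (Mz : ℝ) * 2 ^ (-(t : ℤ)) * (2 : ℝ) ^ sh * (1 + 1 / (2 : ℝ) ^ P) := by ring
  exact hvalX'.trans_le key

/-! ### Logarithmic accuracy -/

/-- **Accuracy predicate**: `(M, E)` is a normalised float whose value is within `ε` of `x > 0` in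
`log₂`. [cite: JacobsonWilliams2008, §11.1 Def. 11.1 ((f, p) representation)] -/
def Acc (P : ℕ) (M E : ℤ) (x ε : ℝ) : Prop :=
  IsNorm P M ∧ 0 < x ∧ |Real.logb 2 (val M E) - Real.logb 2 x| ≤ ε

/-- `log₂ (1 + 1/2^P) ≤ 2/2^P`. [folklore] -/
theorem logb_one_add_le (P : ℕ) : Real.logb 2 (1 + 1 / (2 : ℝ) ^ P) ≤ 2 / (2 : ℝ) ^ P := by
  have hP : (0 : ℝ) < (2 : ℝ) ^ P := by positivity
  have h1 : Real.log (1 + 1 / (2 : ℝ) ^ P) ≤ 1 / (2 : ℝ) ^ P := by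
    have := Real.log_le_sub_one_of_pos (by positivity : (0 : ℝ) < 1 + 1 / (2 : ℝ) ^ P)
    linarith
  have hl2 := Real.log_two_gt_d9
  unfold Real.logb
  rw [div_le_div_iff₀ (by linarith) hP]
  have h3 : Real.log (1 + 1 / (2 : ℝ) ^ P) * (2 : ℝ) ^ P ≤ 1 := by
    calc Real.log (1 + 1 / (2 : ℝ) ^ P) * (2 : ℝ) ^ P ≤ (1 / (2 : ℝ) ^ P) * (2 : ℝ) ^ P := by gcongr
      _ = 1 := by field_simp
  linarith

/-- **From value bounds to accuracy**: `val ≤ x < val (1 + 1/2^P)` gives accuracy `2/2^P`.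
[cite: JacobsonWilliams2008, §11.1] -/
theorem acc_of_bounds {P : ℕ} {M E : ℤ} {x : ℝ} (hN : IsNorm P M) (h1 : val M E ≤ x)
    (h2 : x < val M E * (1 + 1 / (2 : ℝ) ^ P)) : Acc P M E x (2 / (2 : ℝ) ^ P) := by
  have hv := hN.val_pos E
  have hx : 0 < x := lt_of_lt_of_le hv h1
  refine ⟨hN, hx, ?_⟩
  have hlo : Real.logb 2 (val M E) ≤ Real.logb 2 x := Real.logb_le_logb_of_le (by norm_num) hv h1
  have hhi : Real.logb 2 x < Real.logb 2 (val M E) + Real.logb 2 (1 + 1 / (2 : ℝ) ^ P) := by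
    rw [← Real.logb_mul hv.ne' (by positivity)]
    exact Real.logb_lt_logb (by norm_num) hx h2
  have := logb_one_add_le P
  rw [abs_le]; constructor <;> linarith

/-- Accuracy transfers along a close target. [folklore] -/
theorem Acc.congr_right {P : ℕ} {M E : ℤ} {x y ε δ : ℝ} (h : Acc P M E x ε) (hy : 0 < y)
    (hxy : |Real.logb 2 x - Real.logb 2 y| ≤ δ) : Acc P M E y (ε + δ) := by
  refine ⟨h.1, hy, ?_⟩
  have := h.2.2
  calc |Real.logb 2 (val M E) - Real.logb 2 y|
      = |(Real.logb 2 (val M E) - Real.logb 2 x) + (Real.logb 2 x - Real.logb 2 y)| := by ring_nf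
    _ ≤ |Real.logb 2 (val M E) - Real.logb 2 x| + |Real.logb 2 x - Real.logb 2 y| := abs_add_le _ _
    _ ≤ ε + δ := add_le_add this hxy

/-- Accuracy is monotone in the error. [folklore] -/
theorem Acc.mono {P : ℕ} {M E : ℤ} {x ε ε' : ℝ} (h : Acc P M E x ε) (hε : ε ≤ ε') : Acc P M E x ε' :=
  ⟨h.1, h.2.1, h.2.2.trans hε⟩

/-- **Accuracy of a product**: errors add, plus one truncation `2/2^P`.
[cite: JacobsonWilliams2008, §11.1 Lemma 11.3 (products of (f, p) representations)] -/
theorem Acc.mulF {P : ℕ} {M₁ E₁ M₂ E₂ : ℤ} {x y ε₁ ε₂ : ℝ} (h₁ : Acc P M₁ E₁ x ε₁) (h₂ : Acc P M₂ E₂ y ε₂) :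
    Acc P (mulF P M₁ E₁ M₂ E₂).1 (mulF P M₁ E₁ M₂ E₂).2 (x * y) (ε₁ + ε₂ + 2 / (2 : ℝ) ^ P) := by
  obtain ⟨hN, hle, hlt⟩ := mulF_spec h₁.1 h₂.1 E₁ E₂
  have hacc := acc_of_bounds hN hle hlt
  have hv1 := h₁.1.val_pos E₁
  have hv2 := h₂.1.val_pos E₂
  have hxy : |Real.logb 2 (val M₁ E₁ * val M₂ E₂) - Real.logb 2 (x * y)| ≤ ε₁ + ε₂ := by
    rw [Real.logb_mul hv1.ne' hv2.ne', Real.logb_mul h₁.2.1.ne' h₂.2.1.ne']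
    calc |Real.logb 2 (val M₁ E₁) + Real.logb 2 (val M₂ E₂) - (Real.logb 2 x + Real.logb 2 y)|
        = |(Real.logb 2 (val M₁ E₁) - Real.logb 2 x) + (Real.logb 2 (val M₂ E₂) - Real.logb 2 y)| := by ring_nf
      _ ≤ _ := abs_add_le _ _
      _ ≤ ε₁ + ε₂ := add_le_add h₁.2.2 h₂.2.2
  have := hacc.congr_right (mul_pos h₁.2.1 h₂.2.1) hxy
  exact this.mono (by linarith)

/-- **Accuracy of the float of a rational.** [cite: KnuthTAOCP2, §4.2.1] -/
theorem acc_floatOf {P : ℕ} {u v : ℤ} (hu : 1 ≤ u) (hv : 1 ≤ v) (hsz : isize u ≤ P + 3 + isize v) :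
    Acc P (floatOf P u v).1 (floatOf P u v).2 (u / v) (2 / (2 : ℝ) ^ P) := by
  obtain ⟨hN, hle, hlt⟩ := floatOf_spec hu hv hsz
  exact acc_of_bounds hN hle hlt

/-- **One unit of error on a `k`-bit quantity**: `|u - U| ≤ 1`, `2^k ≤ U`, `k ≥ 1` give
`|log₂ u - log₂ U| ≤ 4/2^k`. [folklore] -/
theorem abs_logb_sub_logb_le {u U : ℝ} {k : ℕ} (hk : 1 ≤ k) (hU : (2 : ℝ) ^ k ≤ U) (h : |u - U| ≤ 1) :
    |Real.logb 2 u - Real.logb 2 U| ≤ 4 / (2 : ℝ) ^ k := by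
  have h2k : (2 : ℝ) ≤ (2 : ℝ) ^ k := by
    calc (2 : ℝ) = 2 ^ 1 := by norm_num
      _ ≤ 2 ^ k := pow_le_pow_right₀ (by norm_num) hk
  have hUpos : 0 < U := by linarith
  rw [abs_le] at h
  have hupos : 0 < u := by linarith
  have hl2 := Real.log_two_gt_d9
  have hkpos : (0 : ℝ) < (2 : ℝ) ^ k := by positivity
  set δ := 1 / (2 : ℝ) ^ k with hδ
  have hδU : 1 / U ≤ δ := by rw [hδ]; exact one_div_le_one_div_of_le hkpos hU
  have hδle : δ ≤ 1 / 2 := by rw [hδ]; exact one_div_le_one_div_of_le (by norm_num) h2k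
  have hδpos : 0 < δ := by positivity
  -- ratio bounds `1 - δ ≤ u/U ≤ 1 + δ`
  have hr1 : u / U ≤ 1 + δ := by
    rw [div_le_iff₀ hUpos]
    have : u ≤ U + 1 := by linarith
    calc u ≤ U + 1 := this
      _ = (1 + 1 / U) * U := by field_simp
      _ ≤ (1 + δ) * U := by gcongr
  have hr2 : 1 - δ ≤ u / U := by
    rw [le_div_iff₀ hUpos]
    calc (1 - δ) * U ≤ (1 - 1 / U) * U := by gcongr
      _ = U - 1 := by field_simp
      _ ≤ u := by linarith
  have hrpos : 0 < u / U := div_pos hupos hUpos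
  -- logarithm bounds
  have hup : Real.log (u / U) ≤ δ := by
    have := Real.log_le_sub_one_of_pos hrpos; linarith
  have hdown : -(2 * δ) ≤ Real.log (u / U) := by
    have h1 := Real.one_sub_inv_le_log_of_pos hrpos
    have h2 : (u / U)⁻¹ ≤ (1 - δ)⁻¹ := by
      rw [inv_le_inv₀ hrpos (by linarith)]; exact hr2
    have h3 : (1 - δ)⁻¹ ≤ 1 + 2 * δ := by
      rw [inv_le_comm₀ (by linarith) (by linarith), inv_eq_one_div, div_le_iff₀ (by linarith)]
      nlinarith
    linarith
  rw [← Real.logb_div hupos.ne' hUpos.ne']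
  have habs : |Real.log (u / U)| ≤ 2 * δ := abs_le.mpr ⟨by linarith, hup.trans (by linarith)⟩
  unfold Real.logb
  rw [abs_div, abs_of_pos (by linarith : (0:ℝ) < Real.log 2), div_le_div_iff₀ (by linarith) hkpos]
  have e : δ * (2 : ℝ) ^ k = 1 := by rw [hδ]; field_simp
  nlinarith [habs, hkpos, abs_nonneg (Real.log (u / U))]

/-- **Reading `⌊log₂ x⌋` off the float**: with accuracy `ε`, `E + P - ε ≤ log₂ x < E + P + 1 + ε`.
[cite: JacobsonWilliams2008, §11.1 (k and log₂ θ)] -/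
theorem Acc.logb_bounds {P : ℕ} {M E : ℤ} {x ε : ℝ} (h : Acc P M E x ε) :
    ((E + P : ℤ) : ℝ) - ε ≤ Real.logb 2 x ∧ Real.logb 2 x < ((E + P + 1 : ℤ) : ℝ) + ε := by
  obtain ⟨h1, h2⟩ := h.1.logb_bounds E
  have h3 := h.2.2
  rw [abs_le] at h3
  constructor <;> linarith

end Literature.Computability.Cryptography.UnitResidue

end
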